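import Summits.QuantumFields.YangMills.Theorems.ColdStartUniversalityLatticeLangevinLiebRobinsonCouplingFlow
import HarnessLib

/-!
# Route `ColdStartUniversality` (fixed-cut-off SZZ dynamics; LIEB–ROBINSON / LOCALITY package, file 41):
# ★★★ THE COUPLING LIGHT CONE — the cold-start expectation of a local observable is Lipschitz in the coupling, uniformly in the volume

Helper file (seat `ym-line-csu-p1`, g32; `--supports stmt-QuantumFields-24809`).  Pointwise and solution forms of the coupling comparison of file 40
(`abs_integral_mul_transition_sub_transition_le_coupling`) for the `SU(2)` lattice Langevin dynamics of Shen–Zhu–Zhu on `(ℤ/L)³`, EVERY pair of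
couplings `β₁, β₂`, every volume:
* ★★★ `transition_sub_transition_abs_le_coupling` — for `C³` `f` with link-Lipschitz profile `ℓ^F` and EVERY start `x`:
  `|κ¹_tF(x) − κ²_tF(x)| ≤ 13824π·|β₁ − β₂|·t·e^(λ₂t)·Σ_e ℓ^F_e`, `λ₂ = (1300+4√2)|β₂|` (concentration of test functions at `μ_(β₁)`,
  `nonpos_of_integral_testFunction_mul_nonpos`);
* ★★★ `solution_sub_solution_abs_le_coupling` — two strong solutions at couplings `β₁`, `β₂` from the same deterministic start (e.g. the COLD
  START), on any two filtered probability spaces: `|E f(coords U¹_t) − E f(coords U²_t)| ≤ 13824π·|β₁ − β₂|·t·e^(λ₂t)·Σ_e ℓ^F_e`.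
The DYNAMIC counterpart, at every coupling, of g31's static coupling response (`…LiebRobinsonCouplingLipschitz`: `⟨W⟩_(μ_b)` Lipschitz in `b`
at `|b| < 1/12`): along the cold-start evolution the law of a local observable depends on the coupling only through the links inside its backward
light cone, with a volume-free constant.  THEOREMS ONLY, no definition, no sorry; [folklore].  HONEST FRAMING: fixed cut-off; the constant grows
like `t·e^(λ₂t)`, `λ₂ ∝ |β₂|` — no `K`-uniform statement in physical units along `β'_K = (γε_K)⁻¹/2 → ∞`; `UniformColdStartMixing` (24809) is NOT
restated; no crux, rung or summit statement is proved; the Yang–Mills mass gap is NOT proved.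
-/

set_option autoImplicit false

noncomputable section

namespace Summit.QuantumFields.YangMills.Theorems.ColdStartUniversality.LiebRobinson

open MeasureTheory ProbabilityTheory Matrix Complex Finset Filter Set Metric
open scoped ComplexConjugate BigOperators Matrix NNReal ENNReal Topology
open Literature.Probability.Process Literature.MathematicalPhysics.QuantumFieldTheory
open Literature.MathematicalPhysics.QuantumFieldTheory.Balaban1983to89
open Literature.MathematicalPhysics.QuantumLattice (fundamentalRep fundamentalLatticeRep continuous_fundamentalRep fundamentalRep_apply)

variable {L : ℕ} [NeZero L]

/-! ## §1. Pointwise: the cold-start expectation of a local observable is Lipschitz in the coupling, uniformly in the volume -/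

/-- ★★★ **THE COUPLING LIGHT CONE (every pair of couplings, every volume, every start).**  For a `C³` function `f` of the real link coordinates
whose pull-back `F = f∘coords` has the link-Lipschitz profile `ℓ^F ≥ 0`, Markov kernel families `κ¹, κ²` realising the SZZ transition laws at
`β₁, β₂`, every lattice time `t` and EVERY configuration `x`:
`|κ¹_tF(x) − κ²_tF(x)| ≤ 13824π·|β₁ − β₂|·t·e^(λ₂t)·Σ_e ℓ^F_e`, `λ₂ = |β₂|(4+4√2+12·108)` — the expectation of a local observable along the
dynamics started at a point responds to a change of the coupling LIPSCHITZ-continuously with a constant that sees only the profile of `F`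
(not the `3L³` plaquettes of the action): by file 40 and the concentration lemma `nonpos_of_integral_testFunction_mul_nonpos` at `μ_(β₁)`.
[folklore] -/
theorem transition_sub_transition_abs_le_coupling (L : ℕ) [NeZero L] (β₁ β₂ : ℝ)
    (κ₁ : ℝ≥0 → Kernel (GaugeConfig 3 L (Matrix.specialUnitaryGroup (Fin 2) ℂ))
      (GaugeConfig 3 L (Matrix.specialUnitaryGroup (Fin 2) ℂ))) [∀ t, IsMarkovKernel (κ₁ t)]
    (hreal₁ : ∀ (t : ℝ≥0) (x : GaugeConfig 3 L (Matrix.specialUnitaryGroup (Fin 2) ℂ))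
        (Ω : Type) [MeasurableSpace Ω] (P : Measure Ω) [IsProbabilityMeasure P]
        (W : ℝ≥0 → Ω → (Edge 3 L × NoiseIdx 2 → ℝ)) (hW : IsFlatBrownian W P)
        (U : ℝ≥0 → Ω → GaugeConfig 3 L (Matrix.specialUnitaryGroup (Fin 2) ℂ)),
        (∀ ω, U 0 ω = x) →
        (latticeLangevinDynamics (fundamentalLatticeRep 2) β₁).IsSolution (fundamentalRep (Fin 2))
          hW.natFiltration P W U →
        κ₁ t x = P.map (U t))
    (κ₂ : ℝ≥0 → Kernel (GaugeConfig 3 L (Matrix.specialUnitaryGroup (Fin 2) ℂ))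
      (GaugeConfig 3 L (Matrix.specialUnitaryGroup (Fin 2) ℂ))) [∀ t, IsMarkovKernel (κ₂ t)]
    (hreal₂ : ∀ (t : ℝ≥0) (x : GaugeConfig 3 L (Matrix.specialUnitaryGroup (Fin 2) ℂ))
        (Ω : Type) [MeasurableSpace Ω] (P : Measure Ω) [IsProbabilityMeasure P]
        (W : ℝ≥0 → Ω → (Edge 3 L × NoiseIdx 2 → ℝ)) (hW : IsFlatBrownian W P)
        (U : ℝ≥0 → Ω → GaugeConfig 3 L (Matrix.specialUnitaryGroup (Fin 2) ℂ)),
        (∀ ω, U 0 ω = x) →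
        (latticeLangevinDynamics (fundamentalLatticeRep 2) β₂).IsSolution (fundamentalRep (Fin 2))
          hW.natFiltration P W U →
        κ₂ t x = P.map (U t))
    {f : (Edge 3 L × Fin 2 × Fin 2 × Bool → ℝ) → ℝ} (hf : ContDiff ℝ 3 f) {ℓF : Edge 3 L → ℝ} (hℓF : ∀ e, 0 ≤ ℓF e)
    (t : ℝ≥0) (x : (GaugeConfig 3 L (Matrix.specialUnitaryGroup (Fin 2) ℂ))) :
    let coords : GaugeConfig 3 L (Matrix.specialUnitaryGroup (Fin 2) ℂ) → (Edge 3 L × Fin 2 × Fin 2 × Bool → ℝ) :=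
      fun V q => (fun z : ℂ => if q.2.2.2 then z.im else z.re)
        ((fundamentalRep (Fin 2) (V q.1) : Matrix (Fin 2) (Fin 2) ℂ) q.2.1 q.2.2.1)
    (∀ (e : Edge 3 L) (y y' : (GaugeConfig 3 L (Matrix.specialUnitaryGroup (Fin 2) ℂ))), (∀ f', f' ≠ e → y f' = y' f') →
      |f (coords y) - f (coords y')| ≤ ℓF e * frobNorm ((y e : Matrix (Fin 2) (Fin 2) ℂ) - (y' e : Matrix (Fin 2) (Fin 2) ℂ))) →
    |(∫ y, f (coords y) ∂(κ₁ t x)) - ∫ y, f (coords y) ∂(κ₂ t x)| ≤ 13824 * Real.pi * |β₁ - β₂| * (t : ℝ) * Real.exp ((|β₂| * (4 + 4 * Real.sqrt 2 + 12 * 108)) * (t : ℝ)) * (∑ e : Edge 3 L, ℓF e) := by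
  intro coords hLf
  classical
  haveI := secondCountableTopology_su2
  haveI := borelSpace_config L
  set μ : Measure (GaugeConfig 3 L (Matrix.specialUnitaryGroup (Fin 2) ℂ)) := (wilsonMeasure (d := 3) (L := L) (fundamentalRep (Fin 2)) β₁) with hμ
  haveI : IsProbabilityMeasure μ :=
    isProbabilityMeasure_wilsonMeasure (d := 3) (L := L) (fundamentalRep (Fin 2)) (continuous_fundamentalRep (Fin 2)) β₁
  have hco : Continuous coords := continuous_coords (L := L)
  have hInt : ∀ {Ψ : (GaugeConfig 3 L (Matrix.specialUnitaryGroup (Fin 2) ℂ)) → ℝ}, Continuous Ψ → Integrable Ψ μ := fun hΨ => integrable_of_continuous_of_compactSpace hΨ μ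
  set B : ℝ := 13824 * Real.pi * |β₁ - β₂| * (t : ℝ) * Real.exp ((|β₂| * (4 + 4 * Real.sqrt 2 + 12 * 108)) * (t : ℝ)) * (∑ e : Edge 3 L, ℓF e) with hB
  -- cut-off of `f`
  obtain ⟨f₁, hf₁, hf₁c, hf₁eq⟩ := exists_contDiff_hasCompactSupport_eqOn (n := 3) hf 1
  have hfv : ∀ y : (GaugeConfig 3 L (Matrix.specialUnitaryGroup (Fin 2) ℂ)), f₁ (coords y) = f (coords y) := fun y => (hf₁eq _ (norm_coords_le_one y)).self_of_nhds
  have hLf₁ : ∀ (e : Edge 3 L) (y y' : (GaugeConfig 3 L (Matrix.specialUnitaryGroup (Fin 2) ℂ))), (∀ f', f' ≠ e → y f' = y' f') →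
      |f₁ (coords y) - f₁ (coords y')| ≤ ℓF e * frobNorm ((y e : Matrix (Fin 2) (Fin 2) ℂ) - (y' e : Matrix (Fin 2) (Fin 2) ℂ)) := by
    intro e y y' hyy'; rw [hfv y, hfv y']; exact hLf e y y' hyy'
  -- continuous representatives of `κ¹_t F₁`, `κ²_t F₁`
  obtain ⟨p1, hp1, -, hp1rep⟩ := transitionKernel_preserves_dynkinClass L β₁ κ₁ hreal₁ t hf₁
  obtain ⟨p2, hp2, -, hp2rep⟩ := transitionKernel_preserves_dynkinClass L β₂ κ₂ hreal₂ t hf₁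
  have hP1 : ∀ y : (GaugeConfig 3 L (Matrix.specialUnitaryGroup (Fin 2) ℂ)), ∫ z, f₁ (coords z) ∂(κ₁ t y) = p1 (coords y) := fun y => hp1rep y
  have hP2 : ∀ y : (GaugeConfig 3 L (Matrix.specialUnitaryGroup (Fin 2) ℂ)), ∫ z, f₁ (coords z) ∂(κ₂ t y) = p2 (coords y) := fun y => hp2rep y
  have hflow := fun (h : (Edge 3 L × Fin 2 × Fin 2 × Bool → ℝ) → ℝ) (hh : ContDiff ℝ 3 h) (hhc : HasCompactSupport h)
      (hh0 : ∀ y : (GaugeConfig 3 L (Matrix.specialUnitaryGroup (Fin 2) ℂ)), 0 ≤ h (coords y)) =>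
    abs_integral_mul_transition_sub_transition_le_coupling L β₁ β₂ κ₁ hreal₁ κ₂ hreal₂ hf₁ hf₁c hℓF hh hhc t hh0 hLf₁
  have hside : ∀ (s : ℝ), (s = 1 ∨ s = -1) → ∀ x₀ : (GaugeConfig 3 L (Matrix.specialUnitaryGroup (Fin 2) ℂ)), (fun z => s * (p1 z - p2 z) - B) (coords x₀) ≤ 0 := by
    intro s hs x₀
    have hΦc : Continuous fun z => s * (p1 z - p2 z) - B := (continuous_const.mul (hp1.continuous.sub hp2.continuous)).sub continuous_const
    refine nonpos_of_integral_testFunction_mul_nonpos L β₁ hΦc x₀ fun h hh hhc hh0 => ?_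
    have hb := hflow h hh hhc hh0
    have cH : Continuous fun y : (GaugeConfig 3 L (Matrix.specialUnitaryGroup (Fin 2) ℂ)) => h (coords y) := hh.continuous.comp hco
    have c1 : Continuous fun y : (GaugeConfig 3 L (Matrix.specialUnitaryGroup (Fin 2) ℂ)) => p1 (coords y) := hp1.continuous.comp hco
    have c2 : Continuous fun y : (GaugeConfig 3 L (Matrix.specialUnitaryGroup (Fin 2) ℂ)) => p2 (coords y) := hp2.continuous.comp hco
    have i1 : Integrable (fun y => h (coords y) * p1 (coords y)) μ := hInt (cH.mul c1)
    have i2 : Integrable (fun y => h (coords y) * p2 (coords y)) μ := hInt (cH.mul c2)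
    have i3 : Integrable (fun y => B * h (coords y)) μ := (hInt cH).const_mul B
    have e1 : ∫ y, h (coords y) * (∫ z, f₁ (coords z) ∂(κ₁ t y)) ∂μ = ∫ y, h (coords y) * p1 (coords y) ∂μ :=
      integral_congr_ae (ae_of_all _ fun y => by simp only [hP1 y])
    have e2 : ∫ y, h (coords y) * (∫ z, f₁ (coords z) ∂(κ₂ t y)) ∂μ = ∫ y, h (coords y) * p2 (coords y) ∂μ :=
      integral_congr_ae (ae_of_all _ fun y => by simp only [hP2 y])
    rw [e1, e2] at hb
    have e3 : ∫ y, h (coords y) * ((fun z => s * (p1 z - p2 z) - B) (coords y)) ∂μ =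
        s * (∫ y, h (coords y) * p1 (coords y) ∂μ - ∫ y, h (coords y) * p2 (coords y) ∂μ) - B * ∫ y, h (coords y) ∂μ := by
      have i4 : Integrable (fun y => s * (h (coords y) * p1 (coords y) - h (coords y) * p2 (coords y))) μ := (i1.sub i2).const_mul s
      rw [← integral_sub i1 i2, ← MeasureTheory.integral_const_mul, ← MeasureTheory.integral_const_mul, ← integral_sub i4 i3]
      refine integral_congr_ae (ae_of_all _ fun y => ?_)
      show h (coords y) * (s * (p1 (coords y) - p2 (coords y)) - B) = _
      ring
    rw [e3]
    have hB' : B * ∫ y, h (coords y) ∂μ = 13824 * Real.pi * |β₁ - β₂| * (t : ℝ) * Real.exp ((|β₂| * (4 + 4 * Real.sqrt 2 + 12 * 108)) * (t : ℝ)) * (∑ e : Edge 3 L, ℓF e) * ∫ y, h (coords y) ∂μ := by rw [hB]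
    rcases hs with hs1 | hs1 <;> rw [hs1]
    · have := (abs_le.1 hb).2; linarith
    · have := (abs_le.1 hb).1; linarith
  have h1 := hside 1 (Or.inl rfl) x
  have h2 := hside (-1) (Or.inr rfl) x
  simp only at h1 h2
  have eP1 : ∫ y, f (coords y) ∂(κ₁ t x) = p1 (coords x) := by
    rw [← hP1 x]; exact integral_congr_ae (ae_of_all _ fun y => by simp only [hfv y])
  have eP2 : ∫ y, f (coords y) ∂(κ₂ t x) = p2 (coords x) := by
    rw [← hP2 x]; exact integral_congr_ae (ae_of_all _ fun y => by simp only [hfv y])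
  rw [eP1, eP2, abs_le]
  constructor <;> linarith

/-! ## §2. Two solutions at two couplings from the same start -/

/-- ★★★ **Two cold-start SZZ evolutions at different couplings stay close on local observables, uniformly in the volume.**  Let `U¹` be a strong
solution at coupling `β₁` and `U²` one at coupling `β₂`, on possibly different filtered probability spaces with their own flat Brownian drivers,
both started at the same configuration `x₀` (e.g. the COLD START `U_0 ≡ 1`).  For a `C³` `f` whose pull-back has the link-Lipschitz profile `ℓ^F`
and every lattice time `t`:  `|E f(coords U¹_t) − E f(coords U²_t)| ≤ 13824π·|β₁ − β₂|·t·e^(λ₂t)·Σ_e ℓ^F_e`.  Fixed cut-off; `UniformColdStartMixing`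
(24809) is NOT restated; the Yang–Mills mass gap is NOT proved. [folklore] -/
theorem solution_sub_solution_abs_le_coupling (L : ℕ) [NeZero L] (β₁ β₂ : ℝ) (t : ℝ≥0) (x₀ : (GaugeConfig 3 L (Matrix.specialUnitaryGroup (Fin 2) ℂ)))
    (Ω₁ : Type) [MeasurableSpace Ω₁] (P₁ : Measure Ω₁) [IsProbabilityMeasure P₁]
    (W₁ : ℝ≥0 → Ω₁ → (Edge 3 L × NoiseIdx 2 → ℝ)) (hW₁ : IsFlatBrownian W₁ P₁)
    (U₁ : ℝ≥0 → Ω₁ → (GaugeConfig 3 L (Matrix.specialUnitaryGroup (Fin 2) ℂ))) (hU₁0 : ∀ ω, U₁ 0 ω = x₀)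
    (hU₁ : (latticeLangevinDynamics (fundamentalLatticeRep 2) β₁).IsSolution (fundamentalRep (Fin 2)) hW₁.natFiltration P₁ W₁ U₁)
    (Ω₂ : Type) [MeasurableSpace Ω₂] (P₂ : Measure Ω₂) [IsProbabilityMeasure P₂]
    (W₂ : ℝ≥0 → Ω₂ → (Edge 3 L × NoiseIdx 2 → ℝ)) (hW₂ : IsFlatBrownian W₂ P₂)
    (U₂ : ℝ≥0 → Ω₂ → (GaugeConfig 3 L (Matrix.specialUnitaryGroup (Fin 2) ℂ))) (hU₂0 : ∀ ω, U₂ 0 ω = x₀)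
    (hU₂ : (latticeLangevinDynamics (fundamentalLatticeRep 2) β₂).IsSolution (fundamentalRep (Fin 2)) hW₂.natFiltration P₂ W₂ U₂)
    {f : (Edge 3 L × Fin 2 × Fin 2 × Bool → ℝ) → ℝ} (hf : ContDiff ℝ 3 f) {ℓF : Edge 3 L → ℝ} (hℓF : ∀ e, 0 ≤ ℓF e) :
    let coords : GaugeConfig 3 L (Matrix.specialUnitaryGroup (Fin 2) ℂ) → (Edge 3 L × Fin 2 × Fin 2 × Bool → ℝ) :=
      fun V q => (fun z : ℂ => if q.2.2.2 then z.im else z.re)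
        ((fundamentalRep (Fin 2) (V q.1) : Matrix (Fin 2) (Fin 2) ℂ) q.2.1 q.2.2.1)
    (∀ (e : Edge 3 L) (y y' : (GaugeConfig 3 L (Matrix.specialUnitaryGroup (Fin 2) ℂ))), (∀ f', f' ≠ e → y f' = y' f') →
      |f (coords y) - f (coords y')| ≤ ℓF e * frobNorm ((y e : Matrix (Fin 2) (Fin 2) ℂ) - (y' e : Matrix (Fin 2) (Fin 2) ℂ))) →
    |(∫ ω, f (coords (U₁ t ω)) ∂P₁) - ∫ ω, f (coords (U₂ t ω)) ∂P₂| ≤ 13824 * Real.pi * |β₁ - β₂| * (t : ℝ) * Real.exp ((|β₂| * (4 + 4 * Real.sqrt 2 + 12 * 108)) * (t : ℝ)) * (∑ e : Edge 3 L, ℓF e) := by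
  intro coords hLf
  classical
  haveI := secondCountableTopology_su2
  haveI := borelSpace_config L
  obtain ⟨κ₁, hκ₁, -, hreal₁⟩ := exists_transitionKernel L β₁
  obtain ⟨κ₂, hκ₂, -, hreal₂⟩ := exists_transitionKernel L β₂
  haveI := hκ₁
  haveI := hκ₂
  have h := transition_sub_transition_abs_le_coupling L β₁ β₂ κ₁ hreal₁ κ₂ hreal₂ hf hℓF t x₀ hLf
  have hlaw₁ : κ₁ t x₀ = P₁.map (U₁ t) := hreal₁ t x₀ Ω₁ P₁ W₁ hW₁ U₁ hU₁0 hU₁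
  have hlaw₂ : κ₂ t x₀ = P₂.map (U₂ t) := hreal₂ t x₀ Ω₂ P₂ W₂ hW₂ U₂ hU₂0 hU₂
  have hmU₁ : Measurable (U₁ t) := (hU₁.adapted t).mono (hW₁.natFiltration.le t) le_rfl
  have hmU₂ : Measurable (U₂ t) := (hU₂.adapted t).mono (hW₂.natFiltration.le t) le_rfl
  have hco : Continuous coords := continuous_coords (L := L)
  have hFm : Measurable fun y : (GaugeConfig 3 L (Matrix.specialUnitaryGroup (Fin 2) ℂ)) => f (coords y) := (hf.continuous.comp hco).measurable
  have e1 : ∫ y, f (coords y) ∂(κ₁ t x₀) = ∫ ω, f (coords (U₁ t ω)) ∂P₁ := by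
    rw [hlaw₁, integral_map hmU₁.aemeasurable hFm.aestronglyMeasurable]
  have e2 : ∫ y, f (coords y) ∂(κ₂ t x₀) = ∫ ω, f (coords (U₂ t ω)) ∂P₂ := by
    rw [hlaw₂, integral_map hmU₂.aemeasurable hFm.aestronglyMeasurable]
  rw [← e1, ← e2]
  exact h

/-! ## §3. Wilson loops -/

/-- ★★★ **A Wilson loop along two cold-start evolutions at different couplings** (every pair of couplings, every volume): for a loop word `w` and
strong solutions `U¹` (coupling `β₁`), `U²` (coupling `β₂`) from the same deterministic start on any two filtered probability spaces,
`|E Re tr w(U¹_t) − E Re tr w(U²_t)| ≤ 13824π·|β₁ − β₂|·t·e^(λ₂t)·2π|w|²` (word profile `2π|w|` on the links of `w`, `Σ_e ℓ_e ≤ 2π|w|²`).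
Fixed cut-off; the Yang–Mills mass gap is NOT proved. [folklore] -/
theorem wilson_loop_solution_sub_solution_abs_le_coupling (L : ℕ) [NeZero L] (β₁ β₂ : ℝ) (t : ℝ≥0) (x₀ : (GaugeConfig 3 L (Matrix.specialUnitaryGroup (Fin 2) ℂ)))
    (Ω₁ : Type) [MeasurableSpace Ω₁] (P₁ : Measure Ω₁) [IsProbabilityMeasure P₁]
    (W₁ : ℝ≥0 → Ω₁ → (Edge 3 L × NoiseIdx 2 → ℝ)) (hW₁ : IsFlatBrownian W₁ P₁)
    (U₁ : ℝ≥0 → Ω₁ → (GaugeConfig 3 L (Matrix.specialUnitaryGroup (Fin 2) ℂ))) (hU₁0 : ∀ ω, U₁ 0 ω = x₀)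
    (hU₁ : (latticeLangevinDynamics (fundamentalLatticeRep 2) β₁).IsSolution (fundamentalRep (Fin 2)) hW₁.natFiltration P₁ W₁ U₁)
    (Ω₂ : Type) [MeasurableSpace Ω₂] (P₂ : Measure Ω₂) [IsProbabilityMeasure P₂]
    (W₂ : ℝ≥0 → Ω₂ → (Edge 3 L × NoiseIdx 2 → ℝ)) (hW₂ : IsFlatBrownian W₂ P₂)
    (U₂ : ℝ≥0 → Ω₂ → (GaugeConfig 3 L (Matrix.specialUnitaryGroup (Fin 2) ℂ))) (hU₂0 : ∀ ω, U₂ 0 ω = x₀)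
    (hU₂ : (latticeLangevinDynamics (fundamentalLatticeRep 2) β₂).IsSolution (fundamentalRep (Fin 2)) hW₂.natFiltration P₂ W₂ U₂)
    (l₁ : List (Edge 3 L × Bool)) :
    let coords : GaugeConfig 3 L (Matrix.specialUnitaryGroup (Fin 2) ℂ) → (Edge 3 L × Fin 2 × Fin 2 × Bool → ℝ) :=
      fun V q => (fun z : ℂ => if q.2.2.2 then z.im else z.re)
        ((fundamentalRep (Fin 2) (V q.1) : Matrix (Fin 2) (Fin 2) ℂ) q.2.1 q.2.2.1)
    |(∫ ω, (fun y : (Edge 3 L × Fin 2 × Fin 2 × Bool → ℝ) => ((l₁.map (fun a : Edge 3 L × Bool => if a.2 then ((fun (ee : Edge 3 L) => Matrix.of fun (i j : Fin 2) => ((y (ee, i, j, false) : ℝ) : ℂ) + ((y (ee, i, j, true) : ℝ) : ℂ) * Complex.I) a.1)ᴴ else (fun (ee : Edge 3 L) => Matrix.of fun (i j : Fin 2) => ((y (ee, i, j, false) : ℝ) : ℂ) + ((y (ee, i, j, true) : ℝ) : ℂ) * Complex.I) a.1)).prod).trace.re) (coords (U₁ t ω)) ∂P₁) - ∫ ω,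 (fun y : (Edge 3 L × Fin 2 × Fin 2 × Bool → ℝ) => ((l₁.map (fun a : Edge 3 L × Bool => if a.2 then ((fun (ee : Edge 3 L) => Matrix.of fun (i j : Fin 2) => ((y (ee, i, j, false) : ℝ) : ℂ) + ((y (ee, i, j, true) : ℝ) : ℂ) * Complex.I) a.1)ᴴ else (fun (ee : Edge 3 L) => Matrix.of fun (i j : Fin 2) => ((y (ee, i, j, false) : ℝ) : ℂ) + ((y (ee, i, j, true) : ℝ) : ℂ) * Complex.I) a.1)).prod).trace.re) (coords (U₂ t ω)) ∂P₂| ≤ 13824 * Real.pi * |β₁ - β₂| * (t : ℝ) * Real.exp ((|β₂| * (4 + 4 * Real.sqrt 2 + 12 * 108)) * (t : ℝ)) * (2 * Real.pi * (l₁.length : ℝ) ^ 2) := by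
  intro coords
  classical
  set ℓF : Edge 3 L → ℝ := fun e => if e ∈ (l₁.map Prod.fst).toFinset then 2 * Real.pi * (l₁.length : ℝ) else 0 with hℓF
  have hℓF0 : ∀ e, 0 ≤ ℓF e := fun e => by
    simp only [hℓF]; split_ifs
    · positivity
    · exact le_rfl
  have hLf := word_linkLipschitz_profile L β₁ l₁
  have key := solution_sub_solution_abs_le_coupling L β₁ β₂ t x₀ Ω₁ P₁ W₁ hW₁ U₁ hU₁0 hU₁ Ω₂ P₂ W₂ hW₂ U₂ hU₂0 hU₂
    (contDiff_word (L := L) l₁ (m := 3)) hℓF0 (fun e y y' h => hLf e y y' h)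
  refine key.trans ?_
  have hS : (∑ e : Edge 3 L, ℓF e) ≤ 2 * Real.pi * (l₁.length : ℝ) ^ 2 := sum_word_profile_le (L := L) l₁
  have hpre : 0 ≤ 13824 * Real.pi * |β₁ - β₂| * (t : ℝ) * Real.exp ((|β₂| * (4 + 4 * Real.sqrt 2 + 12 * 108)) * (t : ℝ)) := by positivity
  exact mul_le_mul_of_nonneg_left hS hpre

end Summit.QuantumFields.YangMills.Theorems.ColdStartUniversality.LiebRobinson

end
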